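import Summits.KontsevichZagierPeriods.Zeta5Search.Certificates.RecordRayLineMax
import HarnessLib

/-!
# ζ(5) search — certificates: the telescoping majorant of `|R_b(k+iY)|` on the lattice line (record ray)
(cell `pub-zeta5`, certifier 2, generation 2)

HONEST FRAMING: systematic search; no irrationality claim unless certified.

OUR work (Summit side). Continuation of `Certificates/RecordRayLineMax.lean` (`N(k) ≤ Mx` for all `k ∈ ℤ`).
With the decay certificates (`stepDen·(a+1/2)⁴ ≤ stepNum·(a−1/2)⁴` for `a ≥ 20n`, `Certificates/RecordRayLineDecay*`):

* `NSq_int_decay` — for `|k + h| ≥ 20n + 1/2`: `N(k)·(k+h)⁴ ≤ Mx·(20n+1/2)⁴`;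
* `norm_Rc_int_le_major`, `hasSum_major` — the TELESCOPING MAJORANT
  `|R_b(k+iY)| ≤ g(k) = √Mx·(20n+3)(20n+4)/((|k−k₀|+1)(|k−k₀|+2))` (`k₀ = −⌊(41n+2)/2⌋`),
  `Σ_{k∈ℤ} g(k) = (3/2)·√Mx·(20n+3)(20n+4)` — the inputs `hle`, `hg` of `DualPF.coeffW_abs_le` /
  `coeffU_abs_le` (`Certificates/RecordRayCoeffBound.lean`).
-/

noncomputable section

open Finset Complex Filter Topology

namespace Summit.KontsevichZagierPeriods.Zeta5Search.RecordLine

open Summit.KontsevichZagierPeriods.Zeta5Search.DualSeries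
open Summit.KontsevichZagierPeriods.Zeta5Search.DualSeriesBounds (natB natB_zero natB_succ)
open Summit.KontsevichZagierPeriods.Zeta5Search.DualPF (Rc)

/-! ### Lattice centre, majorant, telescoping sums -/

/-- The lattice centre `k₀ = −⌊(41n+2)/2⌋`, `|k₀ + h| ≤ 1/2`. -/
def kCtr (n : ℕ) : ℤ := -(((41 * n + 2 : ℕ) : ℤ) / 2)

/-- `|k₀ + h| ≤ 1/2`. -/
theorem abs_kCtr_add_le (n : ℕ) : |(kCtr n : ℝ) + ((((41 * n : ℕ) : ℝ) + 2) / 2)| ≤ 1 / 2 := by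
  unfold kCtr
  set x : ℤ := ((41 * n + 2 : ℕ) : ℤ) with hx
  have hqr : 2 * (x / 2) + x % 2 = x := Int.mul_ediv_add_emod x 2
  have hr : x % 2 = 0 ∨ x % 2 = 1 := Int.emod_two_eq_zero_or_one x
  have hxR : ((41 * n : ℕ) : ℝ) + 2 = (x : ℝ) := by rw [hx]; push_cast; ring
  have hqrR : 2 * ((x / 2 : ℤ) : ℝ) + ((x % 2 : ℤ) : ℝ) = (x : ℝ) := by exact_mod_cast hqr
  rw [hxR, abs_le]
  push_cast
  rcases hr with h0 | h1
  · have : ((x % 2 : ℤ) : ℝ) = 0 := by exact_mod_cast h0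
    constructor <;> linarith
  · have : ((x % 2 : ℤ) : ℝ) = 1 := by exact_mod_cast h1
    constructor <;> linarith

/-- The majorant `g(k) = √Mx·(20n+3)(20n+4)/((|k−k₀|+1)(|k−k₀|+2))`. -/
def major (e n : ℕ) (Y : ℝ) (k : ℤ) : ℝ :=
  Real.sqrt (Mx e n Y) * ((20 * n + 3) * (20 * n + 4)) / ((|((k - kCtr n : ℤ) : ℝ)| + 1) * (|((k - kCtr n : ℤ) : ℝ)| + 2))

/-- `Σ_{m≥0} 1/((m+a+1)(m+a+2)) = 1/(a+1)` for `a = 0, 1` — telescoping. -/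
theorem hasSum_telescope_nat (a : ℕ) :
    HasSum (fun m : ℕ => 1 / (((m : ℝ) + a + 1) * ((m : ℝ) + a + 2))) (1 / ((a : ℝ) + 1)) := by
  have hnn : ∀ m : ℕ, 0 ≤ 1 / (((m : ℝ) + a + 1) * ((m : ℝ) + a + 2)) := fun m => by positivity
  rw [hasSum_iff_tendsto_nat_of_nonneg hnn]
  have hpartial : ∀ N : ℕ, ∑ i ∈ range N, 1 / (((i : ℝ) + a + 1) * ((i : ℝ) + a + 2)) =
      1 / ((a : ℝ) + 1) - 1 / ((N : ℝ) + a + 1) := by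
    intro N
    induction N with
    | zero => simp
    | succ N ih =>
      rw [sum_range_succ, ih]
      push_cast
      field_simp
      ring
  simp_rw [hpartial]
  have h0 : Tendsto (fun N : ℕ => 1 / ((N : ℝ) + a + 1)) atTop (𝓝 0) := by
    have := (tendsto_one_div_add_atTop_nhds_zero_nat (𝕜 := ℝ)).comp (tendsto_add_atTop_nat a)
    refine this.congr fun N => ?_
    simp only [Function.comp]
    push_cast
    ring_nf
  simpa using ((tendsto_const_nhds (x := (1 / ((a : ℝ) + 1) : ℝ))).sub h0)

/-- `Σ_{j∈ℤ} 1/((|j|+1)(|j|+2)) = 3/2`. -/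
theorem hasSum_inv_abs : HasSum (fun j : ℤ => 1 / ((|(j : ℝ)| + 1) * (|(j : ℝ)| + 2))) (3 / 2) := by
  have h1 := hasSum_telescope_nat 0
  have h2 := hasSum_telescope_nat 1
  simp only [Nat.cast_zero, add_zero, zero_add, div_one, Nat.cast_one] at h1 h2
  have hf₁ : HasSum (fun m : ℕ => 1 / ((|((m : ℤ) : ℝ)| + 1) * (|((m : ℤ) : ℝ)| + 2))) 1 := by
    refine h1.congr_fun fun m => ?_
    rw [Int.cast_natCast, abs_of_nonneg (Nat.cast_nonneg m)]
  have hf₂ : HasSum (fun m : ℕ => 1 / ((|((-((m : ℤ) + 1) : ℤ) : ℝ)| + 1) * (|((-((m : ℤ) + 1) : ℤ) : ℝ)| + 2)))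
      (1 / 2) := by
    rw [show (1 / 2 : ℝ) = 1 / (1 + 1) by norm_num]
    refine h2.congr_fun fun m => ?_
    have : |((-((m : ℤ) + 1) : ℤ) : ℝ)| = m + 1 := by
      push_cast; rw [abs_neg, abs_of_nonneg (by positivity)]
    rw [this]
  have h := HasSum.of_nat_of_neg_add_one (f := fun j : ℤ => 1 / ((|(j : ℝ)| + 1) * (|(j : ℝ)| + 2))) hf₁ hf₂
  rw [show (1 : ℝ) + 1 / 2 = 3 / 2 by norm_num] at h
  exact h

/-- **`Σ_{k∈ℤ} g(k) = (3/2)·√Mx·(20n+3)(20n+4)`.** -/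
theorem hasSum_major (e n : ℕ) (Y : ℝ) :
    HasSum (major e n Y) (3 / 2 * (Real.sqrt (Mx e n Y) * ((20 * n + 3) * (20 * n + 4)))) := by
  have h := ((Equiv.subRight (kCtr n)).hasSum_iff.2 hasSum_inv_abs).mul_left
    (Real.sqrt (Mx e n Y) * ((20 * n + 3) * (20 * n + 4)))
  rw [show Real.sqrt (Mx e n Y) * ((20 * n + 3) * (20 * n + 4)) * (3 / 2 : ℝ) =
    3 / 2 * (Real.sqrt (Mx e n Y) * ((20 * n + 3) * (20 * n + 4))) by ring] at h
  refine h.congr_fun fun k => ?_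
  simp only [Function.comp, Equiv.subRight_apply, major]
  push_cast
  ring

/-! ### Decay away from the centre and the majorant bound -/

section Lattice

variable {e n : ℕ} (he : e ≤ 1) (hn : 1 ≤ n) {Y : ℝ} (hY : 0 < Y)
  (hcert : ∀ a : ℝ, 1 / 2 ≤ a → stepDen e n Y a ≤ stepNum e n Y a)
  (hdec : ∀ a : ℝ, 20 * n ≤ a → stepDen e n Y a * (a + 1 / 2) ^ 4 ≤ stepNum e n Y a * (a - 1 / 2) ^ 4)
include he hn hY hcert hdec


omit hcert in
/-- The decaying step: `N(x)·(x+h)⁴ ≤ N(x+1)·(x+h+1)⁴` for `−(x+h) ≥ 20n + 1/2`. -/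
theorem NSq_decay_step (x : ℝ) (hx : 20 * (n : ℝ) + 1 / 2 ≤ -(x + ((((41 * n : ℕ) : ℝ) + 2) / 2))) :
    NSq e n Y x * (x + ((((41 * n : ℕ) : ℝ) + 2) / 2)) ^ 4 ≤
      NSq e n Y (x + 1) * (x + 1 + ((((41 * n : ℕ) : ℝ) + 2) / 2)) ^ 4 := by
  set h : ℝ := ((((41 * n : ℕ) : ℝ) + 2) / 2) with hh
  set a : ℝ := -x - h - 1 / 2 with ha
  have ha20 : 20 * (n : ℝ) ≤ a := by linarith
  have hd := hdec a ha20
  -- `a + 1/2 = -(x+h)`, `a - 1/2 = -(x+h+1)`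
  have e1 : (a + 1 / 2) ^ 4 = (x + h) ^ 4 := by rw [show a + 1 / 2 = -(x + h) by rw [ha]; ring]; ring
  have e2 : (a - 1 / 2) ^ 4 = (x + 1 + h) ^ 4 := by rw [show a - 1 / 2 = -(x + 1 + h) by rw [ha]; ring]; ring
  rw [e1, e2] at hd
  -- from `Den·(x+h)^4 ≤ Num·(x+h+1)^4` and `N(x)·Den-side = ...`: use the normalised identities
  have hreg := hreg_recE he hn
  have h0 := normSq_Rc_mul (41 * n) (BrecE e n) hreg (x := x) hY.ne'
  have h1 := normSq_Rc_mul (41 * n) (BrecE e n) hreg (x := x + 1) hY.ne'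
  have hD0 := Dx_pos (41 * n) (BrecE e n) hY x
  have hD1 := Dx_pos (41 * n) (BrecE e n) hY (x + 1)
  have hN := Nm_step (41 * n) Y x
  have hDs := Dx_step (41 * n) (BrecE e n) hreg Y x
  have ha' : a = -x - ((41 * n : ℕ) + 2 : ℝ) / 2 - 1 / 2 := by rw [ha, hh]
  rw [ha', stepNum_eq, stepDen_eq e n Y x he hn] at hd
  have hc : 0 < ∏ j ∈ range 7, qsq Y (x + 1 + (BrecE e n j : ℝ)) := prod_pos fun _ _ => by unfold qsq; positivity
  have hq1 : 0 < qsq Y (x + (((41 * n : ℕ) : ℝ) + 2) / 2) * qsq Y (x + 1) := by unfold qsq; positivity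
  have hNm := Nm_pos (41 * n) hY x
  -- key: Nm(x) D(x+1) (x+h)^4 ≤ Nm(x+1) D(x) (x+h+1)^4
  have key : Nm (41 * n) Y x * Dx (41 * n) (BrecE e n) Y (x + 1) * (x + h) ^ 4 ≤
      Nm (41 * n) Y (x + 1) * Dx (41 * n) (BrecE e n) Y x * (x + 1 + h) ^ 4 := by
    have := mul_le_mul_of_nonneg_left hd (mul_pos hNm hD0).le
    have lhs : Nm (41 * n) Y x * Dx (41 * n) (BrecE e n) Y x *
        (qsq Y (x + (((41 * n : ℕ) : ℝ) + 2) / 2) * qsq Y (x + 1) *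
          (∏ j ∈ range 7, qsq Y (x + 1 + ((41 * n + 1 - BrecE e n j : ℕ) : ℝ))) * (x + h) ^ 4) =
        (Nm (41 * n) Y x * Dx (41 * n) (BrecE e n) Y (x + 1) * (x + h) ^ 4) *
          ((qsq Y (x + (((41 * n : ℕ) : ℝ) + 2) / 2) * qsq Y (x + 1)) *
            ∏ j ∈ range 7, qsq Y (x + 1 + (BrecE e n j : ℝ))) := by
      calc Nm (41 * n) Y x * Dx (41 * n) (BrecE e n) Y x *
            (qsq Y (x + (((41 * n : ℕ) : ℝ) + 2) / 2) * qsq Y (x + 1) *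
              (∏ j ∈ range 7, qsq Y (x + 1 + ((41 * n + 1 - BrecE e n j : ℕ) : ℝ))) * (x + h) ^ 4)
          = Nm (41 * n) Y x * (qsq Y (x + (((41 * n : ℕ) : ℝ) + 2) / 2) * qsq Y (x + 1)) * (x + h) ^ 4 *
              (Dx (41 * n) (BrecE e n) Y x *
                ∏ j ∈ range 7, qsq Y (x + 1 + ((41 * n + 1 - BrecE e n j : ℕ) : ℝ))) := by ring
        _ = Nm (41 * n) Y x * (qsq Y (x + (((41 * n : ℕ) : ℝ) + 2) / 2) * qsq Y (x + 1)) * (x + h) ^ 4 *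
              (Dx (41 * n) (BrecE e n) Y (x + 1) * ∏ j ∈ range 7, qsq Y (x + 1 + (BrecE e n j : ℝ))) := by
            rw [hDs]
        _ = _ := by ring
    have rhs : Nm (41 * n) Y x * Dx (41 * n) (BrecE e n) Y x *
        (qsq Y (x + 1 + (((41 * n : ℕ) : ℝ) + 2) / 2) * qsq Y (x + 1 + ((41 * n + 1 : ℕ) : ℝ)) *
          (∏ j ∈ range 7, qsq Y (x + 1 + (BrecE e n j : ℝ))) * (x + 1 + h) ^ 4) =
        (Nm (41 * n) Y (x + 1) * Dx (41 * n) (BrecE e n) Y x * (x + 1 + h) ^ 4) *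
          ((qsq Y (x + (((41 * n : ℕ) : ℝ) + 2) / 2) * qsq Y (x + 1)) *
            ∏ j ∈ range 7, qsq Y (x + 1 + (BrecE e n j : ℝ))) := by
      push_cast at hN ⊢
      calc Nm (41 * n) Y x * Dx (41 * n) (BrecE e n) Y x *
            (qsq Y (x + 1 + ((41 : ℝ) * n + 2) / 2) * qsq Y (x + 1 + ((41 : ℝ) * n + 1)) *
              (∏ j ∈ range 7, qsq Y (x + 1 + (BrecE e n j : ℝ))) * (x + 1 + h) ^ 4)
          = (Nm (41 * n) Y x * (qsq Y (x + 1 + ((41 : ℝ) * n + 2) / 2) * qsq Y (x + 1 + ((41 : ℝ) * n + 1)))) *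
              Dx (41 * n) (BrecE e n) Y x * (∏ j ∈ range 7, qsq Y (x + 1 + (BrecE e n j : ℝ))) *
              (x + 1 + h) ^ 4 := by ring
        _ = (Nm (41 * n) Y (x + 1) * (qsq Y (x + ((41 : ℝ) * n + 2) / 2) * qsq Y (x + 1))) *
              Dx (41 * n) (BrecE e n) Y x * (∏ j ∈ range 7, qsq Y (x + 1 + (BrecE e n j : ℝ))) *
              (x + 1 + h) ^ 4 := by rw [hN]
        _ = _ := by ring
    rw [lhs, rhs] at this
    exact le_of_mul_le_mul_right this (mul_pos hq1 hc)
  have eq0 : NSq e n Y x = Nm (41 * n) Y x / Dx (41 * n) (BrecE e n) Y x := by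
    unfold NSq; rw [eq_div_iff hD0.ne']; exact h0
  have eq1 : NSq e n Y (x + 1) = Nm (41 * n) Y (x + 1) / Dx (41 * n) (BrecE e n) Y (x + 1) := by
    unfold NSq; rw [eq_div_iff hD1.ne']; exact h1
  rw [eq0, eq1, div_mul_eq_mul_div, div_mul_eq_mul_div, div_le_div_iff₀ hD0 hD1]
  calc Nm (41 * n) Y x * (x + h) ^ 4 * Dx (41 * n) (BrecE e n) Y (x + 1)
      = Nm (41 * n) Y x * Dx (41 * n) (BrecE e n) Y (x + 1) * (x + h) ^ 4 := by ring
    _ ≤ Nm (41 * n) Y (x + 1) * Dx (41 * n) (BrecE e n) Y x * (x + 1 + h) ^ 4 := key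
    _ = Nm (41 * n) Y (x + 1) * (x + 1 + h) ^ 4 * Dx (41 * n) (BrecE e n) Y x := by ring

/-- **Decay to the left**: for `k ∈ ℤ` with `k + h ≤ −(20n + 1/2)`: `N(k)·(k+h)⁴ ≤ Mx·(20n+1/2)⁴`. -/
theorem NSq_int_decay_left (k : ℤ) (hk : (k : ℝ) + ((((41 * n : ℕ) : ℝ) + 2) / 2) ≤ -(20 * n + 1 / 2)) :
    NSq e n Y k * ((k : ℝ) + ((((41 * n : ℕ) : ℝ) + 2) / 2)) ^ 4 ≤ Mx e n Y * (20 * n + 1 / 2) ^ 4 := by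
  set h : ℝ := ((((41 * n : ℕ) : ℝ) + 2) / 2) with hh
  set v : ℝ := (k : ℝ) + h with hv
  set c : ℝ := 20 * n + 1 / 2 with hc
  set m : ℕ := ⌊-v - c⌋₊ + 1 with hm
  have hvc : 0 ≤ -v - c := by linarith
  have hfl : ((⌊-v - c⌋₊ : ℕ) : ℝ) ≤ -v - c := Nat.floor_le hvc
  have hfl' : -v - c < ((⌊-v - c⌋₊ : ℕ) : ℝ) + 1 := Nat.lt_floor_add_one _
  have hmR : (m : ℝ) = ((⌊-v - c⌋₊ : ℕ) : ℝ) + 1 := by rw [hm]; push_cast; ring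
  have hiter : NSq e n Y (k : ℝ) * ((k : ℝ) + h) ^ 4 ≤ NSq e n Y ((k : ℝ) + m) * ((k : ℝ) + m + h) ^ 4 :=
    iter_threshold (F := fun x => NSq e n Y x * (x + h) ^ 4) (h := h) (c := c)
      (fun x hx => NSq_decay_step he hn hY hdec x hx) m k (by rw [hmR]; linarith)
  refine hiter.trans ?_
  -- at the landing point: `|v + m| ≤ c` and `N ≤ Mx`
  have hland1 : -(v + m) < c := by rw [hmR]; linarith
  have hland2 : c - 1 ≤ -(v + m) := by rw [hmR]; linarith
  have hn1 : (1 : ℝ) ≤ n := by exact_mod_cast hn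
  have hc1 : 1 ≤ c := by rw [hc]; linarith
  have habs : |(k : ℝ) + m + h| ≤ c := by
    rw [abs_le]; constructor <;> linarith
  have hpow : ((k : ℝ) + m + h) ^ 4 ≤ c ^ 4 := by
    have := pow_le_pow_left₀ (abs_nonneg _) habs 4
    rwa [pow_abs, abs_of_nonneg (by positivity : (0 : ℝ) ≤ ((k : ℝ) + m + h) ^ 4)] at this
  have hN : NSq e n Y ((k : ℝ) + m) ≤ Mx e n Y := by
    have := NSq_int_le_Mx he hn hY hcert (k + m)
    push_cast at this
    exact this
  calc NSq e n Y ((k : ℝ) + m) * ((k : ℝ) + m + h) ^ 4 ≤ Mx e n Y * c ^ 4 :=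
        mul_le_mul hN hpow (by positivity) (Mx_nonneg _ _ _)
    _ = Mx e n Y * (20 * n + 1 / 2) ^ 4 := by rw [hc]

/-- **Decay on both sides**: for `k ∈ ℤ` with `|k + h| ≥ 20n + 1/2`: `N(k)·(k+h)⁴ ≤ Mx·(20n+1/2)⁴`. -/
theorem NSq_int_decay (k : ℤ) (hk : 20 * (n : ℝ) + 1 / 2 ≤ |(k : ℝ) + ((((41 * n : ℕ) : ℝ) + 2) / 2)|) :
    NSq e n Y k * ((k : ℝ) + ((((41 * n : ℕ) : ℝ) + 2) / 2)) ^ 4 ≤ Mx e n Y * (20 * n + 1 / 2) ^ 4 := by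
  set h : ℝ := ((((41 * n : ℕ) : ℝ) + 2) / 2) with hh
  by_cases hneg : (k : ℝ) + h ≤ 0
  · rw [abs_of_nonpos hneg] at hk
    exact NSq_int_decay_left he hn hY hcert hdec k (by linarith)
  · push Not at hneg
    rw [abs_of_pos hneg] at hk
    -- reflect to `k' = −(41n+2) − k`
    set k' : ℤ := -((41 * n + 2 : ℕ) : ℤ) - k with hk'
    have hsymm := NSq_symm_int he hn hY k
    have e2 : (k' : ℝ) + h = -((k : ℝ) + h) := by rw [hk', hh]; push_cast; ring
    have hleft := NSq_int_decay_left he hn hY hcert hdec k' (by rw [e2]; linarith)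
    rw [hsymm, e2] at hleft
    calc NSq e n Y k * ((k : ℝ) + h) ^ 4 = NSq e n Y k * (-((k : ℝ) + h)) ^ 4 := by ring
      _ ≤ Mx e n Y * (20 * n + 1 / 2) ^ 4 := hleft

/-! ### The telescoping majorant -/

/-- **`|R_b(k+iY)| ≤ g(k)` for every `k ∈ ℤ`.** -/
theorem norm_Rc_int_le_major (k : ℤ) :
    ‖Rc (natB (41 * n) (BrecE e n)) ((k : ℂ) + Y * I)‖ ≤ major e n Y k := by
  set h : ℝ := ((((41 * n : ℕ) : ℝ) + 2) / 2) with hh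
  set J : ℝ := |((k - kCtr n : ℤ) : ℝ)| with hJ
  have hJ0 : 0 ≤ J := abs_nonneg _
  have hMx := Mx_nonneg e n Y
  have hsq : ‖Rc (natB (41 * n) (BrecE e n)) ((k : ℂ) + Y * I)‖ ^ 2 = NSq e n Y k := by
    unfold NSq; push_cast; rfl
  have hnorm0 : 0 ≤ ‖Rc (natB (41 * n) (BrecE e n)) ((k : ℂ) + Y * I)‖ := norm_nonneg _
  -- global bound `‖R‖ ≤ √Mx`
  have hglob : ‖Rc (natB (41 * n) (BrecE e n)) ((k : ℂ) + Y * I)‖ ≤ Real.sqrt (Mx e n Y) := by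
    rw [← Real.sqrt_sq hnorm0, hsq]
    exact Real.sqrt_le_sqrt (NSq_int_le_Mx he hn hY hcert k)
  unfold major
  rw [← hJ]
  have hden : 0 < (J + 1) * (J + 2) := by positivity
  rw [le_div_iff₀ hden]
  by_cases hJc : J ≤ 20 * n + 2
  · -- near the centre: `(J+1)(J+2) ≤ (20n+3)(20n+4)`
    calc ‖Rc (natB (41 * n) (BrecE e n)) ((k : ℂ) + Y * I)‖ * ((J + 1) * (J + 2))
        ≤ Real.sqrt (Mx e n Y) * ((J + 1) * (J + 2)) := by gcongr
      _ ≤ Real.sqrt (Mx e n Y) * ((20 * n + 3) * (20 * n + 4)) := by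
          apply mul_le_mul_of_nonneg_left _ (Real.sqrt_nonneg _)
          nlinarith
  · push Not at hJc
    -- far: use the decay `N(k)·v⁴ ≤ Mx·c⁴` with `|v| ≥ J − 1/2 ≥ 20n + 1/2`
    have hctr := abs_kCtr_add_le n
    have hv : J - 1 / 2 ≤ |(k : ℝ) + h| := by
      have e1 : (k : ℝ) + h = (((k - kCtr n : ℤ) : ℝ)) + ((kCtr n : ℝ) + h) := by push_cast; ring
      rw [e1]
      have := abs_sub_abs_le_abs_sub (((k - kCtr n : ℤ) : ℝ)) (-((kCtr n : ℝ) + h))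
      rw [sub_neg_eq_add, abs_neg] at this
      have hctr' : |(kCtr n : ℝ) + h| ≤ 1 / 2 := by rw [hh]; exact hctr
      linarith [hJ]
    have hvc : 20 * (n : ℝ) + 1 / 2 ≤ |(k : ℝ) + h| := by linarith
    have hdk := NSq_int_decay he hn hY hcert hdec k hvc
    have hvpos : 0 < |(k : ℝ) + h| := by
      have : (1 : ℝ) ≤ n := by exact_mod_cast hn
      linarith
    -- integrality: `J ≥ 20n + 3`
    have hJ3 : (20 : ℝ) * n + 3 ≤ J := by
      have hJnat : J = (((k - kCtr n).natAbs : ℕ) : ℝ) := by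
        rw [hJ, Nat.cast_natAbs, Int.cast_abs]
      rw [hJnat] at hJc ⊢
      have : 20 * n + 2 < (k - kCtr n).natAbs := by exact_mod_cast hJc
      exact_mod_cast (show 20 * n + 3 ≤ (k - kCtr n).natAbs by omega)
    -- `‖R‖ · v² ≤ √Mx · c²`
    have hRv : ‖Rc (natB (41 * n) (BrecE e n)) ((k : ℂ) + Y * I)‖ * ((k : ℝ) + h) ^ 2 ≤
        Real.sqrt (Mx e n Y) * (20 * n + 1 / 2) ^ 2 := by
      have hsq2 : (‖Rc (natB (41 * n) (BrecE e n)) ((k : ℂ) + Y * I)‖ * ((k : ℝ) + h) ^ 2) ^ 2 ≤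
          (Real.sqrt (Mx e n Y) * (20 * n + 1 / 2) ^ 2) ^ 2 := by
        rw [mul_pow, mul_pow, hsq, Real.sq_sqrt hMx, ← pow_mul, ← pow_mul]
        exact hdk
      exact (pow_le_pow_iff_left₀ (by positivity) (by positivity) two_ne_zero).1 hsq2
    have hv2 : (J - 1 / 2) ^ 2 ≤ ((k : ℝ) + h) ^ 2 := by
      have hJh : 0 ≤ J - 1 / 2 := by linarith
      have := pow_le_pow_left₀ hJh hv 2
      rwa [sq_abs] at this
    have hvsq : 0 < ((k : ℝ) + h) ^ 2 := by rw [← sq_abs]; exact pow_pos hvpos 2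
    -- the domination inequality `c²(J+1)(J+2) ≤ (20n+3)(20n+4)(J−1/2)²`
    have hpoly : (20 * (n : ℝ) + 1 / 2) ^ 2 * ((J + 1) * (J + 2)) ≤ ((20 * n + 3) * (20 * n + 4)) * (J - 1 / 2) ^ 2 := by
      have hn1 : (1 : ℝ) ≤ n := by exact_mod_cast hn
      obtain ⟨s', t', hs', ht', eJ, en⟩ : ∃ s' t' : ℝ, 0 ≤ s' ∧ 0 ≤ t' ∧ J = 20 * n + 3 + s' ∧ (n : ℝ) = 1 + t' :=
        ⟨J - 20 * n - 3, n - 1, by linarith, by linarith, by ring, by ring⟩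
      have key : ((20 * (n : ℝ) + 3) * (20 * n + 4)) * (J - 1 / 2) ^ 2 - (20 * (n : ℝ) + 1 / 2) ^ 2 * ((J + 1) * (J + 2)) =
          27300 + 68830 * t' + 57600 * t' ^ 2 + 16000 * t' ^ 3 + 16991 / 4 * s' + 7390 * s' * t' + 3200 * s' * t' ^ 2
            + 527 / 4 * s' ^ 2 + 120 * s' ^ 2 * t' := by
        rw [eJ, en]; ring
      have : 0 ≤ 27300 + 68830 * t' + 57600 * t' ^ 2 + 16000 * t' ^ 3 + 16991 / 4 * s' + 7390 * s' * t' + 3200 * s' * t' ^ 2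
            + 527 / 4 * s' ^ 2 + 120 * s' ^ 2 * t' := by positivity
      linarith
    refine le_of_mul_le_mul_right ?_ hvsq
    calc ‖Rc (natB (41 * n) (BrecE e n)) ((k : ℂ) + Y * I)‖ * ((J + 1) * (J + 2)) * ((k : ℝ) + h) ^ 2
        = (‖Rc (natB (41 * n) (BrecE e n)) ((k : ℂ) + Y * I)‖ * ((k : ℝ) + h) ^ 2) * ((J + 1) * (J + 2)) := by ring
      _ ≤ (Real.sqrt (Mx e n Y) * (20 * n + 1 / 2) ^ 2) * ((J + 1) * (J + 2)) := by gcongr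
      _ = Real.sqrt (Mx e n Y) * ((20 * n + 1 / 2) ^ 2 * ((J + 1) * (J + 2))) := by ring
      _ ≤ Real.sqrt (Mx e n Y) * (((20 * n + 3) * (20 * n + 4)) * (J - 1 / 2) ^ 2) :=
          mul_le_mul_of_nonneg_left hpoly (Real.sqrt_nonneg _)
      _ ≤ Real.sqrt (Mx e n Y) * (((20 * n + 3) * (20 * n + 4)) * ((k : ℝ) + h) ^ 2) := by gcongr
      _ = Real.sqrt (Mx e n Y) * ((20 * n + 3) * (20 * n + 4)) * ((k : ℝ) + h) ^ 2 := by ring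

end Lattice

end Summit.KontsevichZagierPeriods.Zeta5Search.RecordLine
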